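import Mathlib
import Summits.NavierStokesRegularity.NavierStokesRegularity.Theorems.FilamentSkeletonRssClause13CutoffCommutator

/-!
# Clause 13-J/13-R, brick B5/B8 (frequency cut-offs, REFINED): the transport commutator splits as
# `[k∗, w]∂f = −w′(x)·((t·k′ + k)∗f)(x) + E`, `‖E‖₂ ≤ Λ₂(‖t²k′‖₁ + ‖t·k‖₁)‖f‖₂` when `|w″| ≤ Λ₂`

Route `FilamentSkeletonRss`, ∃-side clause 13 (`Clause13RNearStraightL` stmt-NavierStokesRegularity-23612; typing-agnostic); design of record
`filament-plan/DESIGN-NOTE-28296-tenure-g22.md` §4–§6 (commutators "need only `w′ ∈ L∞`"; §6(a): in the class `w′ = ½ + S_tt` varies on the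
partner scale `ρ√Γ`, so `w″` is SMALL).  Why the refinement: the first-order bound `‖[k∗,w]∂f‖₂ ≤ Λ(‖t k′‖₁+‖k‖₁)‖f‖₂` (p693953) is of ORDER ONE in
`f`, which the band and elliptic regimes absorb (gains `≫ Λ`) but the FAR TRANSPORT BRANCH cannot (its gain is the J-averaged growth `¾ = O(1)`,
p696498).  Expanding `w` to second order moves the order-one part onto the convolution with `g := t·k′ + k`, whose transform is `−ξ·k̂′(ξ)`:
it lives where `k̂` VARIES, i.e. in the transition window between two slices — a window the neighbouring (band) estimate controls with a large
gain — and leaves a remainder of size `Λ₂·(width of k)`: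

* §1 `abs_sub_sub_deriv_mul_le` — `|w(y) − w(x) − w′(x)(y−x)| ≤ Λ₂(y−x)²` and `|w′(y) − w′(x)| ≤ Λ₂|y−x|` from `|w″| ≤ Λ₂`;
* §2 `transportCommutator_eq_main_add_remainder` — the pointwise split (on top of the IBP identity `integral_kernel_mul_sub_mul_deriv_eq`, p693953):
  `∫k(x−y)(w(y)−w(x))f′(y)dy = −w′(x)·∫((x−y)k′(x−y) + k(x−y))f(y)dy + ∫Rem(x,y)f(y)dy`,
  `Rem = k′(x−y)(w(y)−w(x)−w′(x)(y−x)) − k(x−y)(w′(y)−w′(x))`;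
* §3 `norm_transportCommutatorRemainder_le`, `integral_sq_norm_transportCommutatorRemainder_le` — `|∫Rem f| ≤ Λ₂∫((x−y)²|k′|+|x−y||k|)(x−y)‖f(y)‖dy`
  and the Schur–Young `L²` bound `(Λ₂(‖t²k′‖₁ + ‖t k‖₁))²∫‖f‖²`; `integral_sq_norm_mainConvolution_le` — `‖(t k′+k)∗f‖₂ ≤ (‖t k′‖₁+‖k‖₁)‖f‖₂`;
* §4 scaling: `‖t²k_μ′‖₁ = μ‖t²k′‖₁` (with p693953's `‖t k_μ‖₁ = μ‖t k‖₁`): the remainder is `O(Λ₂μ)`, i.e. GAINS the core width.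
Lane ns-filament-19175-p1 g16; `--supports stmt-NavierStokesRegularity-23612 --as helper`.
HONEST FRAMING: elementary harmonic analysis attached to a HYPOTHETICAL filament skeleton's linearised operator on the NEGATIVE side of a MODEL route;
nothing here bears on Navier–Stokes regularity or blow-up.
-/

noncomputable section

open MeasureTheory Real Complex Filter Set
open scoped ComplexConjugate

namespace Summit.NavierStokesRegularity.NavierStokesRegularity.Theorems.MatchedKernel
set_option linter.dupNamespace false

/-! ## §1 Second-order Taylor bounds from `|w″| ≤ Λ₂` -/

/-- On the segment between `x` and `y`: `|t − x| ≤ |y − x|`. [folklore] -/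
theorem abs_sub_le_of_mem_uIcc {x y t : ℝ} (ht : t ∈ Set.uIcc x y) : |t - x| ≤ |y - x| := by
  rcases Set.mem_uIcc.1 ht with ⟨h1, h2⟩ | ⟨h1, h2⟩
  · rw [abs_of_nonneg (by linarith), abs_of_nonneg (by linarith)]; linarith
  · rw [abs_of_nonpos (by linarith), abs_of_nonpos (by linarith)]; linarith

/-- **Second-order Taylor bound**: if `w′` is differentiable with `|w″| ≤ Λ₂` then `|w(y) − w(x) − w′(x)(y − x)| ≤ Λ₂(y − x)²`
(mean value inequality for `t ↦ w(t) − w′(x)t` on the segment, where its derivative is `≤ Λ₂|y−x|`). [folklore] -/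
theorem abs_sub_sub_deriv_mul_le {w : ℝ → ℝ} (hw : Differentiable ℝ w) (hw2 : Differentiable ℝ (deriv w)) {Λ₂ : ℝ}
    (hΛ₂ : ∀ t, |deriv (deriv w) t| ≤ Λ₂) (x y : ℝ) :
    |w y - w x - deriv w x * (y - x)| ≤ Λ₂ * (y - x) ^ 2 := by
  have hlip : ∀ t, |deriv w t - deriv w x| ≤ Λ₂ * |t - x| := fun t => abs_sub_le_of_abs_deriv_le hw2 hΛ₂ x t
  set φ : ℝ → ℝ := fun t => w t - deriv w x * t with hφ
  have hφd : ∀ t, HasDerivAt φ (deriv w t - deriv w x) t := by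
    intro t
    have h : HasDerivAt (fun t => w t - deriv w x * t) (deriv w t - deriv w x * 1) t :=
      (hw t).hasDerivAt.fun_sub ((hasDerivAt_id t).const_mul (deriv w x))
    rw [mul_one] at h
    exact h
  have h := Convex.norm_image_sub_le_of_norm_deriv_le (f := φ) (s := Set.uIcc x y) (C := Λ₂ * |y - x|)
    (fun t _ => (hφd t).differentiableAt)
    (fun t ht => by
      rw [(hφd t).deriv, Real.norm_eq_abs]
      exact (hlip t).trans (mul_le_mul_of_nonneg_left (abs_sub_le_of_mem_uIcc ht) ((abs_nonneg _).trans (hΛ₂ 0))))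
    (convex_uIcc x y) Set.left_mem_uIcc Set.right_mem_uIcc
  rw [Real.norm_eq_abs, Real.norm_eq_abs] at h
  have e : φ y - φ x = w y - w x - deriv w x * (y - x) := by simp only [hφ]; ring
  rw [e] at h
  calc |w y - w x - deriv w x * (y - x)| ≤ Λ₂ * |y - x| * |y - x| := h
    _ = Λ₂ * (y - x) ^ 2 := by rw [mul_assoc, ← sq, sq_abs]

/-! ## §2 The split of the transport commutator -/

/-- **REFINED TRANSPORT COMMUTATOR (pointwise split).**  For a `C¹` kernel `k`, `w` with `w′` differentiable, `|w′| ≤ Λ`, `|w″| ≤ Λ₂`, and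
`f ∈ C¹_c`:  `∫k(x−y)(w(y)−w(x))f′(y)dy = −w′(x)·∫((x−y)k′(x−y) + k(x−y))f(y)dy + ∫Rem(x,y)f(y)dy` with
`Rem(x,y) = k′(x−y)(w(y)−w(x)−w′(x)(y−x)) − k(x−y)(w′(y)−w′(x))`. [folklore] -/
theorem transportCommutator_eq_main_add_remainder {k k' : ℝ → ℝ} (hk : ∀ t, HasDerivAt k (k' t) t) (hk'c : Continuous k')
    {w : ℝ → ℝ} (hw : Differentiable ℝ w) (hw2 : Differentiable ℝ (deriv w)) {Λ : ℝ} (hΛ : ∀ t, |deriv w t| ≤ Λ)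
    {f f' : ℝ → ℂ} (hf : ∀ y, HasDerivAt f (f' y) y) (hf'c : Continuous f') (hfs : HasCompactSupport f) (x : ℝ) :
    ∫ y, ((k (x - y) * (w y - w x) : ℝ) : ℂ) * f' y
      = -((deriv w x : ℝ) : ℂ) * (∫ y, (((x - y) * k' (x - y) + k (x - y) : ℝ) : ℂ) * f y)
        + ∫ y, ((k' (x - y) * (w y - w x - deriv w x * (y - x)) - k (x - y) * (deriv w y - deriv w x) : ℝ) : ℂ) * f y := by
  have hkc : Continuous k := continuous_iff_continuousAt.2 fun t => (hk t).continuousAt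
  have hwc : Continuous w := hw.continuous
  have hw'c : Continuous (deriv w) := hw2.continuous
  have hfc : Continuous f := continuous_iff_continuousAt.2 fun t => (hf t).continuousAt
  rw [integral_kernel_mul_sub_mul_deriv_eq hk hk'c hw hΛ hf hf'c hfs x]
  have hsub : Continuous fun y : ℝ => x - y := continuous_const.sub continuous_id
  have hI1 : Integrable (fun y => (((x - y) * k' (x - y) + k (x - y) : ℝ) : ℂ) * f y) :=
    ((Complex.continuous_ofReal.comp ((hsub.mul (hk'c.comp hsub)).add (hkc.comp hsub))).mul hfc).integrable_of_hasCompactSupport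
      hfs.mul_left
  have hI2 : Integrable (fun y => ((k' (x - y) * (w y - w x - deriv w x * (y - x)) - k (x - y) * (deriv w y - deriv w x) : ℝ) : ℂ) * f y) :=
    ((Complex.continuous_ofReal.comp (((hk'c.comp hsub).mul ((hwc.sub continuous_const).sub
      (continuous_const.mul (continuous_id.sub continuous_const)))).sub ((hkc.comp hsub).mul (hw'c.sub continuous_const)))).mul
      hfc).integrable_of_hasCompactSupport hfs.mul_left
  have e : (fun y : ℝ => ((k' (x - y) * (w y - w x) - k (x - y) * deriv w y : ℝ) : ℂ) * f y)
      = fun y : ℝ => -((deriv w x : ℝ) : ℂ) * ((((x - y) * k' (x - y) + k (x - y) : ℝ) : ℂ) * f y)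
        + ((k' (x - y) * (w y - w x - deriv w x * (y - x)) - k (x - y) * (deriv w y - deriv w x) : ℝ) : ℂ) * f y := by
    ext y
    push_cast
    ring
  rw [e, integral_add (hI1.const_mul _) hI2, integral_const_mul]

/-! ## §3 Bounds: the remainder is `O(Λ₂ · width)`, the main convolution is order zero -/

/-- **Pointwise bound on the remainder**: `‖∫Rem(x,y)f(y)dy‖ ≤ ∫ Λ₂((x−y)²|k′(x−y)| + |x−y||k(x−y)|)‖f(y)‖dy`. [folklore] -/
theorem norm_transportCommutatorRemainder_le {k k' : ℝ → ℝ} (hk : ∀ t, HasDerivAt k (k' t) t) (hk'c : Continuous k')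
    {w : ℝ → ℝ} (hw : Differentiable ℝ w) (hw2 : Differentiable ℝ (deriv w)) {Λ₂ : ℝ} (hΛ₂ : ∀ t, |deriv (deriv w) t| ≤ Λ₂)
    {f : ℝ → ℂ} (hfc : Continuous f) (hfs : HasCompactSupport f) (x : ℝ) :
    ‖∫ y, ((k' (x - y) * (w y - w x - deriv w x * (y - x)) - k (x - y) * (deriv w y - deriv w x) : ℝ) : ℂ) * f y‖
      ≤ ∫ y, (Λ₂ * ((x - y) ^ 2 * |k' (x - y)| + |x - y| * |k (x - y)|)) * ‖f y‖ := by
  have hkc : Continuous k := continuous_iff_continuousAt.2 fun t => (hk t).continuousAt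
  have hsub : Continuous fun y : ℝ => x - y := continuous_const.sub continuous_id
  have hKc : Continuous fun y : ℝ => Λ₂ * ((x - y) ^ 2 * |k' (x - y)| + |x - y| * |k (x - y)|) :=
    continuous_const.mul (((hsub.pow 2).mul (hk'c.comp hsub).abs).add (hsub.abs.mul (hkc.comp hsub).abs))
  have hint : Integrable (fun y => (Λ₂ * ((x - y) ^ 2 * |k' (x - y)| + |x - y| * |k (x - y)|)) * ‖f y‖) :=
    (hKc.mul hfc.norm).integrable_of_hasCompactSupport hfs.norm.mul_left
  refine norm_integral_le_of_norm_le hint (ae_of_all _ fun y => ?_)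
  rw [norm_mul, Complex.norm_real, Real.norm_eq_abs]
  have h1 : |w y - w x - deriv w x * (y - x)| ≤ Λ₂ * (y - x) ^ 2 := abs_sub_sub_deriv_mul_le hw hw2 hΛ₂ x y
  have h2 : |deriv w y - deriv w x| ≤ Λ₂ * |y - x| := abs_sub_le_of_abs_deriv_le hw2 hΛ₂ x y
  have hker : |k' (x - y) * (w y - w x - deriv w x * (y - x)) - k (x - y) * (deriv w y - deriv w x)|
      ≤ Λ₂ * ((x - y) ^ 2 * |k' (x - y)| + |x - y| * |k (x - y)|) := by
    calc |k' (x - y) * (w y - w x - deriv w x * (y - x)) - k (x - y) * (deriv w y - deriv w x)|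
        ≤ |k' (x - y) * (w y - w x - deriv w x * (y - x))| + |k (x - y) * (deriv w y - deriv w x)| := abs_sub _ _
      _ = |k' (x - y)| * |w y - w x - deriv w x * (y - x)| + |k (x - y)| * |deriv w y - deriv w x| := by rw [abs_mul, abs_mul]
      _ ≤ |k' (x - y)| * (Λ₂ * (y - x) ^ 2) + |k (x - y)| * (Λ₂ * |y - x|) := by gcongr
      _ = Λ₂ * ((x - y) ^ 2 * |k' (x - y)| + |x - y| * |k (x - y)|) := by
          rw [abs_sub_comm y x, show (y - x) ^ 2 = (x - y) ^ 2 by ring]; ring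
  exact mul_le_mul_of_nonneg_right hker (norm_nonneg _)

/-- The remainder `x ↦ ∫Rem(x,y)f(y)dy` is a.e.-strongly measurable. [folklore] -/
theorem aestronglyMeasurable_transportCommutatorRemainder {k k' : ℝ → ℝ} (hkc : Continuous k) (hk'c : Continuous k')
    {w : ℝ → ℝ} (hwc : Continuous w) (hw'c : Continuous (deriv w)) {f : ℝ → ℂ} (hfc : Continuous f) :
    AEStronglyMeasurable (fun x : ℝ => ∫ y, ((k' (x - y) * (w y - w x - deriv w x * (y - x))
      - k (x - y) * (deriv w y - deriv w x) : ℝ) : ℂ) * f y) volume := by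
  have hF : Continuous fun p : ℝ × ℝ => ((k' (p.1 - p.2) * (w p.2 - w p.1 - deriv w p.1 * (p.2 - p.1))
      - k (p.1 - p.2) * (deriv w p.2 - deriv w p.1) : ℝ) : ℂ) * f p.2 := by
    refine (Complex.continuous_ofReal.comp ?_).mul (hfc.comp continuous_snd)
    exact ((hk'c.comp (continuous_fst.sub continuous_snd)).mul (((hwc.comp continuous_snd).sub (hwc.comp continuous_fst)).sub
      ((hw'c.comp continuous_fst).mul (continuous_snd.sub continuous_fst)))).sub
      ((hkc.comp (continuous_fst.sub continuous_snd)).mul ((hw'c.comp continuous_snd).sub (hw'c.comp continuous_fst)))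
  exact (hF.aestronglyMeasurable (μ := (volume : Measure ℝ).prod volume)).integral_prod_right'

/-- **`L²` BOUND ON THE REMAINDER**: `∫‖∫Rem f‖² ≤ (Λ₂(‖t²k′‖₁ + ‖t k‖₁))²∫‖f‖²` — it GAINS the kernel width (§4). [folklore] -/
theorem integral_sq_norm_transportCommutatorRemainder_le {k k' : ℝ → ℝ} (hk : ∀ t, HasDerivAt k (k' t) t) (hk'c : Continuous k')
    (hk1 : Integrable fun t => t * k t) (hk'2 : Integrable fun t => t ^ 2 * k' t)
    {w : ℝ → ℝ} (hw : Differentiable ℝ w) (hw2 : Differentiable ℝ (deriv w)) {Λ₂ : ℝ} (hΛ₂ : ∀ t, |deriv (deriv w) t| ≤ Λ₂)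
    {f : ℝ → ℂ} (hfc : Continuous f) (hfs : HasCompactSupport f) :
    MemLp (fun x : ℝ => ∫ y, ((k' (x - y) * (w y - w x - deriv w x * (y - x)) - k (x - y) * (deriv w y - deriv w x) : ℝ) : ℂ) * f y)
        2 volume ∧
      ∫ x, ‖∫ y, ((k' (x - y) * (w y - w x - deriv w x * (y - x)) - k (x - y) * (deriv w y - deriv w x) : ℝ) : ℂ) * f y‖ ^ 2
        ≤ (Λ₂ * ((∫ t, t ^ 2 * |k' t|) + ∫ t, |t| * |k t|)) ^ 2 * ∫ y, ‖f y‖ ^ 2 := by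
  have hkc : Continuous k := continuous_iff_continuousAt.2 fun t => (hk t).continuousAt
  have hΛ0 : 0 ≤ Λ₂ := (abs_nonneg _).trans (hΛ₂ 0)
  set K : ℝ → ℝ := fun t => Λ₂ * (t ^ 2 * |k' t| + |t| * |k t|) with hK
  have h1 : Integrable fun t => |t| * |k t| := by
    refine hk1.abs.congr (ae_of_all _ fun t => ?_); simp only [abs_mul]
  have h2 : Integrable fun t => t ^ 2 * |k' t| := by
    refine hk'2.abs.congr (ae_of_all _ fun t => ?_)
    simp only [abs_mul, abs_pow, sq_abs]
  have hKi : Integrable K := (h2.add h1).const_mul Λ₂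
  have hf2 : MemLp f 2 volume := hfc.memLp_of_hasCompactSupport hfs
  have hg := aestronglyMeasurable_transportCommutatorRemainder (k' := k') hkc hk'c hw.continuous hw2.continuous hfc
  have hdom := ae_of_all (volume : Measure ℝ) fun x => norm_transportCommutatorRemainder_le hk hk'c hw hw2 hΛ₂ hfc hfs x
  obtain ⟨hgLp, hle⟩ := integral_sq_norm_le_of_norm_le_integral_mul hKi hf2 hg hdom
  refine ⟨hgLp, hle.trans_eq ?_⟩
  have hKabs : ∫ t, |K t| = Λ₂ * ((∫ t, t ^ 2 * |k' t|) + ∫ t, |t| * |k t|) := by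
    have habs : (fun t => |K t|) = fun t => Λ₂ * (t ^ 2 * |k' t| + |t| * |k t|) :=
      funext fun t => abs_of_nonneg (by positivity)
    rw [habs, integral_const_mul, integral_add h2 h1]
  rw [hKabs]

/-- The main part's convolution is order zero: `∫‖∫((x−y)k′(x−y)+k(x−y))f(y)dy‖² ≤ (‖t k′‖₁ + ‖k‖₁)²∫‖f‖²` (its Fourier transform is
`−ξ·k̂′(ξ)·f̂(ξ)`, supported where `k̂` varies — used by the gluing step, not proved here). [folklore] -/
theorem integral_sq_norm_mainConvolution_le {k k' : ℝ → ℝ} (hkc : Continuous k) (hk'c : Continuous k')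
    (hki : Integrable k) (hk'1 : Integrable fun t => t * k' t) {f : ℝ → ℂ} (hfc : Continuous f) (hfs : HasCompactSupport f) :
    MemLp (fun x : ℝ => ∫ y, (((x - y) * k' (x - y) + k (x - y) : ℝ) : ℂ) * f y) 2 volume ∧
      ∫ x, ‖∫ y, (((x - y) * k' (x - y) + k (x - y) : ℝ) : ℂ) * f y‖ ^ 2 ≤ ((∫ t, |t| * |k' t|) + ∫ t, |k t|) ^ 2 * ∫ y, ‖f y‖ ^ 2 := by
  set K : ℝ → ℝ := fun t => |t| * |k' t| + |k t| with hK
  have h1 : Integrable fun t => |t| * |k' t| := by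
    refine hk'1.abs.congr (ae_of_all _ fun t => ?_); simp only [abs_mul]
  have hKi : Integrable K := h1.add hki.abs
  have hf2 : MemLp f 2 volume := hfc.memLp_of_hasCompactSupport hfs
  have hsub : Continuous fun p : ℝ × ℝ => p.1 - p.2 := continuous_fst.sub continuous_snd
  have hF : Continuous fun p : ℝ × ℝ => (((p.1 - p.2) * k' (p.1 - p.2) + k (p.1 - p.2) : ℝ) : ℂ) * f p.2 :=
    (Complex.continuous_ofReal.comp ((hsub.mul (hk'c.comp hsub)).add (hkc.comp hsub))).mul (hfc.comp continuous_snd)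
  have hg : AEStronglyMeasurable (fun x : ℝ => ∫ y, (((x - y) * k' (x - y) + k (x - y) : ℝ) : ℂ) * f y) volume :=
    (hF.aestronglyMeasurable (μ := (volume : Measure ℝ).prod volume)).integral_prod_right'
  have hdom : ∀ᵐ x ∂volume, ‖∫ y, (((x - y) * k' (x - y) + k (x - y) : ℝ) : ℂ) * f y‖ ≤ ∫ y, K (x - y) * ‖f y‖ := by
    refine ae_of_all _ fun x => ?_
    have hKc : Continuous fun y : ℝ => K (x - y) := by
      simp only [hK]
      exact (((continuous_const.sub continuous_id).abs.mul (hk'c.comp (continuous_const.sub continuous_id)).abs).add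
        (hkc.comp (continuous_const.sub continuous_id)).abs)
    have hint : Integrable (fun y => K (x - y) * ‖f y‖) := (hKc.mul hfc.norm).integrable_of_hasCompactSupport hfs.norm.mul_left
    refine norm_integral_le_of_norm_le hint (ae_of_all _ fun y => ?_)
    rw [norm_mul, Complex.norm_real, Real.norm_eq_abs]
    refine mul_le_mul_of_nonneg_right ?_ (norm_nonneg _)
    calc |(x - y) * k' (x - y) + k (x - y)| ≤ |(x - y) * k' (x - y)| + |k (x - y)| := abs_add_le _ _
      _ = K (x - y) := by rw [hK, abs_mul]
  obtain ⟨hgLp, hle⟩ := integral_sq_norm_le_of_norm_le_integral_mul hKi hf2 hg hdom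
  refine ⟨hgLp, hle.trans_eq ?_⟩
  have hKabs : ∫ t, |K t| = (∫ t, |t| * |k' t|) + ∫ t, |k t| := by
    have habs : (fun t => |K t|) = fun t => |t| * |k' t| + |k t| := funext fun t => abs_of_nonneg (by positivity)
    rw [habs, integral_add h1 hki.abs]
  rw [hKabs]

/-! ## §4 Scaling of the new constant -/

/-- `‖t²·k_μ′‖₁ = μ·‖t²·k′‖₁` for `k_μ = μ⁻¹k(·/μ)` (`k_μ′(t) = μ⁻²k′(t/μ)`): the refined remainder gains the width `μ`. [folklore] -/
theorem integral_sq_mul_abs_deriv_scaledKernel (k' : ℝ → ℝ) {μ : ℝ} (hμ : 0 < μ) :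
    ∫ t, t ^ 2 * |μ⁻¹ * (μ⁻¹ * k' (t / μ))| = μ * ∫ t, t ^ 2 * |k' t| := by
  have h := Measure.integral_comp_div (fun s => (s ^ 2 * |k' s|)) μ
  beta_reduce at h
  calc ∫ t, t ^ 2 * |μ⁻¹ * (μ⁻¹ * k' (t / μ))| = ∫ t, (t / μ) ^ 2 * |k' (t / μ)| := by
        refine integral_congr_ae (ae_of_all _ fun t => ?_)
        dsimp only
        rw [abs_mul, abs_mul, abs_of_pos (inv_pos.2 hμ)]
        field_simp
    _ = |μ| • ∫ y, y ^ 2 * |k' y| := h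
    _ = μ * ∫ t, t ^ 2 * |k' t| := by rw [abs_of_pos hμ, smul_eq_mul]

end Summit.NavierStokesRegularity.NavierStokesRegularity.Theorems.MatchedKernel

end
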